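import Summits.BirchSwinnertonDyer.Rank1Residual.AdditivePotMult.RankOneHeegner
import HarnessLib

/-!
# Rank ONE, ANY prime `p ≥ 5` split in the Heegner field: Kolyvagin's Tamagawa-defect inequality
# relative to the rank-zero Heegner twists' lower halves — the class-agnostic tool behind
# `RankOneHeegner{,Class}.lean`, with the bad-reduction hypothesis removed

HONEST FRAMING (cell `b2b-bsdres`, run/shared/lean/b2b/bsd-rank1-residual/, verbatim in every
file): the goal of the cell is to DELETE the COMBINATION-SHAPED residual classes of the
Birch–Swinnerton-Dyer formula for ALL analytic-rank `≤ 1` elliptic curves over `ℚ` — "full BSD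
formula for every rank `≤ 1` curve in class `C`" assembled STRICTLY from published theorems — so
that the rank-`≤ 1` remainder becomes exactly the CONSTRUCTION-SHAPED classes, which are TYPED
(missing-input `Prop`s), NOT attempted. This is not "finishing BSD". Sub-cell
`b2b-bsdres-additive-p1`, generation 4; research route; NO class theorem for any class other than
X3♯(M)/X4(M)/X4 is claimed here — this file is a TOOL (class-agnostic), offered to the owners of the
rank-one rows of X7 (good supersingular, non-semistable; PAIR WANTED), X11 (multiplicative, ¬(ram))
and to additive-p2/p4 (X4♯); nothing is booked; no label moves.

Theorems only; no definition, no new named fact. `RankOneHeegner.lean` used `p ∣ N_E` only to know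
that `p` SPLITS in the Heegner field `K` (Heegner hypothesis for `N_E`); the Friedberg–Hoffstein
supply of the tree (`friedbergHoffstein_exists_heegnerField_split_twist_ne_zero`) provides a Heegner
field in which, in addition, the given prime `p` splits — whatever the reduction of `E` at `p`. So:

* §1 `padicValRat_u_eq_zero_of_twist_minimal_of_split` — transport (e) from "`p` splits in `K`".
* §2 `padicValNat_shaOrder_le_add_of_heegnerData_of_lowerTwist'` — the data-level theorem of
  `RankOneHeegner.lean` with `p ∣ N` replaced by "`p` splits in `K`".
* §3 **`padicValNat_shaOrder_le_add_of_rankOne_of_lowerTwists`** — for `W/ℚ` globally minimal,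
  `ord_{s=1} L(E,s) = 1`, ANY prime `p ≥ 5` with `E[p]` irreducible and `ρ̄_{E,p}` onto, and a
  parametrisation datum `D` at level `N_E` with `p ∤ c(D)`: IF the lower half `MissingLowerBoundAt`
  holds for every globally minimal model of a rank-zero twist of `E` by an imaginary quadratic
  Heegner field for `N_E` in which `p` splits, THEN `#Ш(E)_an = q ∈ ℚ` with
  `ord_p #Ш(E) ≤ ord_p q + 2·ord_p ∏_ℓ c_ℓ(E)` (binders: Gross–Zagier, Kolyvagin ×2, GZK,
  modularity ×2, Friedberg–Hoffstein); `missingUpperBoundAt_of_rankOne_of_lowerTwists` (`p ∤ ∏c_ℓ`),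
  `bsdp_of_rankOne_of_lower_of_lowerTwists` (+ the pair's own lower half).
* §4 `…_of_not_sq_dvd` — when `p² ∤ N_E` (good or multiplicative `p`) the Manin-unit datum is
  DISCHARGED (modularity + Mazur 1978 Cor. 4.1 + Néron mapping property: x11b's
  `exists_modularParametrizationData_not_dvd`).

Where this says something not already in the tree: rank-one pairs at a GOOD SUPERSINGULAR prime of a
NON-semistable curve (class X7; C3 = Jetchev–Skinner–Wan needs semistability, C2 = BCS needs
ordinary), and rank-one multiplicative pairs WITHOUT (ram) under surjectivity (class X11): there the
upper half of `BSD(E,p)` costs only the rank-zero twists' lower halves. At good ordinary `p` with big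
image everything is C2 (Burungale–Castella–Skinner 2025) already; at multiplicative `p` with (ram) it
is multr1-p2's theorem (Skinner 2016 Thm. C feeds the twist).
-/

noncomputable section

open scoped Classical NumberField

open WeierstrassCurve NumberField Literature.NumberTheory.EllipticCurves
  Literature.NumberTheory.EllipticCurves.ModularForms
  Literature.NumberTheory.EllipticCurves.Rank1Residual
  Literature.NumberTheory.EllipticCurves.Rank1Residual.Typed
  Literature.NumberTheory.Automorphic
  IsDedekindDomain

namespace Summit.BirchSwinnertonDyer.Rank1Residual.AdditivePotMult

/-! ### §1 Transport (e) from "`p` splits in `K`" -/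

/-- **`ord_p u = 0` for the minimal model of the twist by an imaginary quadratic `K` in which `p`
splits** (`SatisfiesHeegnerHypothesis p K`): `d_K ∈ ℚ_p^{×2}`, `p ∤ d_K`, and the argument of x11b's
`padicValRat_u_eq_zero_of_twist_minimal` (adapted verbatim; cf. `…_of_dvd` in `RankOneHeegner.lean`).
[cite: SilvermanAEC2009, VII.1 Prop. 1.3(b) and X.5 Cor. 5.4] -/
theorem padicValRat_u_eq_zero_of_twist_minimal_of_split (W : WeierstrassCurve ℚ) [W.IsElliptic]
    [W.IsGloballyMinimal] (p : ℕ) [Fact p.Prime] (K : Type) [Field K] [NumberField K]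
    (hK : IsImaginaryQuadratic K) (hHp : SatisfiesHeegnerHypothesis p K)
    {Wd : WeierstrassCurve ℚ} [Wd.IsElliptic]
    [Wd.IsGloballyMinimal] (Cd : VariableChange ℚ)
    (hWd : Cd • W.quadraticTwist (NumberField.discr K : ℚ) = Wd) :
    padicValRat p (Cd.u : ℚ) = 0 := by
  -- adapted from Summits/BirchSwinnertonDyer/Rank1Residual/X11b/TwistTransportUnit.lean (multr1-p2)
  have hp : p.Prime := Fact.out
  set d : ℚ := (NumberField.discr K : ℚ) with hd_def
  have hD0 : d ≠ 0 := by rw [hd_def]; exact_mod_cast NumberField.discr_ne_zero K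
  haveI : (W.baseChange ℚ_[p]).IsElliptic :=
    inferInstanceAs (W.map (algebraMap ℚ ℚ_[p])).IsElliptic
  haveI : (W.quadraticTwist d).IsElliptic := W.isElliptic_quadraticTwist hD0
  have hsq : IsSquare (algebraMap ℚ ℚ_[p] d) :=
    X11b.isSquare_discr_padic_of_heegner K hK hHp p (dvd_refl p)
  have hpd : ¬ (p : ℤ) ∣ NumberField.discr K :=
    Literature.SatisfiesHeegnerHypothesis.not_dvd_discr hK.1 hHp hp (dvd_refl p)
  obtain ⟨θ, hθ⟩ := hsq
  have hθ0 : θ ≠ 0 := by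
    rintro rfl
    exact (map_ne_zero (algebraMap ℚ ℚ_[p])).mpr hD0 (hθ.trans (mul_zero 0))
  set X : WeierstrassCurve ℚ_[p] := W.baseChange ℚ_[p] with hX
  set Y : WeierstrassCurve ℚ_[p] := Wd.baseChange ℚ_[p] with hY
  haveI hXmin : X.IsMinimal ℤ_[p] := isMinimal_map_padic_of_isGloballyMinimal W p
  haveI hYmin : Y.IsMinimal ℤ_[p] := isMinimal_map_padic_of_isGloballyMinimal Wd p
  obtain ⟨C, hC⟩ := (W.baseChange ℚ_[p]).exists_variableChange_smul_eq_quadraticTwist_sq hθ0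
  have h1 : (W.quadraticTwist d).baseChange ℚ_[p] = C • X := by
    rw [hC, baseChange, baseChange, map_quadraticTwist, hθ, sq]
  have hYX : Y = (Cd.map (algebraMap ℚ ℚ_[p]) * C) • X := by
    rw [hY, ← hWd, WeierstrassCurve.VariableChange.baseChange_smul_eq (W.quadraticTwist d) Cd ℚ_[p],
      h1, mul_smul]
  set V := (IsDiscreteValuationRing.maximalIdeal ℤ_[p]).valuation ℚ_[p] with hV
  have hval : V Y.Δ = V X.Δ := valuation_Δ_eq_of_isMinimal_of_eq_smul ℤ_[p] hYX
  have hΔd : Wd.Δ = (↑Cd.u⁻¹ : ℚ) ^ 12 * (d ^ 6 * W.Δ) := by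
    rw [← hWd, variableChange_Δ, quadraticTwist_Δ]
  have hYΔ : Y.Δ = algebraMap ℚ ℚ_[p] Wd.Δ := by rw [hY, baseChange, map_Δ]
  have hXΔ : X.Δ = algebraMap ℚ ℚ_[p] W.Δ := by rw [hX, baseChange, map_Δ]
  rw [hYΔ, hXΔ, hΔd] at hval
  simp only [map_mul, map_pow] at hval
  have hΔ0 : V (algebraMap ℚ ℚ_[p] W.Δ) ≠ 0 :=
    (Valuation.ne_zero_iff V).mpr ((map_ne_zero _).mpr W.isUnit_Δ.ne_zero)
  have hvd : V (algebraMap ℚ ℚ_[p] d) = 1 := by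
    have : algebraMap ℚ ℚ_[p] d = ((NumberField.discr K : ℤ) : ℚ_[p]) := by
      rw [hd_def, map_intCast]
    rw [this]
    exact X11b.valuation_maximalIdeal_intCast_eq_one p hpd
  rw [hvd, one_pow, one_mul, mul_left_eq_self₀] at hval
  have hu12 : V (algebraMap ℚ ℚ_[p] (↑Cd.u⁻¹ : ℚ)) ^ 12 = 1 := hval.resolve_right hΔ0
  have hu1 : V (algebraMap ℚ ℚ_[p] (↑Cd.u⁻¹ : ℚ)) = 1 :=
    (pow_eq_one_iff_left (by norm_num)).mp hu12
  have hu : V ((Cd.u : ℚ) : ℚ_[p]) = 1 := by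
    rw [Units.val_inv_eq_inv_val, map_inv₀, map_inv₀, inv_eq_one] at hu1
    rw [← hu1, eq_ratCast]
  exact X11b.padicValRat_eq_zero_of_valuation_eq_one p (Cd.u.ne_zero) hu


variable {W : WeierstrassCurve ℚ} [W.IsElliptic] {p : ℕ} [Fact p.Prime]

/-! ### §2 Data level, any `p ≥ 5` split in `K` -/

/-- **Kolyvagin's Tamagawa defect at fixed Heegner data, ANY prime `p ≥ 5` split in `K` — relative
form** (`padicValNat_shaOrder_le_add_of_heegnerData_of_lowerTwist` with `p ∣ N` replaced by
`SatisfiesHeegnerHypothesis p K`). [cite: McCallumLMS1991, §1 Theorem (Kolyvagin), p. 296]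
[cite: JetchevSkinnerWan2017, §7.4.2 (p. 31)] [cite: Miller2011LMS, Def. 1.1] -/
theorem padicValNat_shaOrder_le_add_of_heegnerData_of_lowerTwist'
    (W : WeierstrassCurve ℚ) [W.IsElliptic] [W.IsGloballyMinimal] (p : ℕ) [Fact p.Prime]
    [NeZero (W.conductorNorm ℤ)] (K : Type) [Field K] [NumberField K]
    (Dt : ModularParametrizationData W (W.conductorNorm ℤ))
    (H : HeegnerDatum (W.conductorNorm ℤ) (NumberField.discr K)) (ι : K →+* ℂ)
    (P : (W.baseChange K).toAffine.Point)
    (hGZ : gross_zagier (W.conductorNorm ℤ) W K) (hKo : kolyvagin (W.conductorNorm ℤ) W K)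
    (hGZK : rank_eq_analyticRank_of_analyticRank_le_one) (hmod : hasEntireLFunction_rat)
    (hr : W.analyticRank = 1) (hp5 : 5 ≤ p) (hirr : Irr W p)
    (hK : IsImaginaryQuadratic K) (hHN : SatisfiesHeegnerHypothesis (W.conductorNorm ℤ) K)
    (hHp : SatisfiesHeegnerHypothesis p K)
    (hP : WeierstrassCurve.Affine.Point.map ι.toRatAlgHom P = heegnerPointComplex Dt H)
    (hc : ¬ (p : ℤ) ∣ Dt.c) (hμ : ¬ p ∣ Units.torsionOrder K)
    (hLt : (W.quadraticTwist (NumberField.discr K : ℚ)).entireLFunction 1 ≠ 0)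
    (Wd : WeierstrassCurve ℚ) [Wd.IsElliptic] [Wd.IsGloballyMinimal] (Cd : VariableChange ℚ)
    (hWd : Cd • W.quadraticTwist (NumberField.discr K : ℚ) = Wd)
    (hlow : MissingLowerBoundAt Wd p)
    (hU : Finite (W.baseChange K).sha → ¬ IsOfFinAddOrder P →
      padicValNat p (Nat.card (W.baseChange K).sha) ≤
        2 * padicValNat p (AddSubgroup.zmultiples P).index) :
    ∃ q : ℚ, shaAn W = (q : ℂ) ∧
      (padicValNat p W.shaOrder : ℤ) ≤ padicValRat p q + 2 * padicValNat p W.tamagawaProduct := by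
  have hp2 : p ≠ 2 := by omega
  have hD0 : (NumberField.discr K : ℚ) ≠ 0 := by exact_mod_cast NumberField.discr_ne_zero K
  haveI hEt : (W.quadraticTwist (NumberField.discr K : ℚ)).IsElliptic :=
    W.isElliptic_quadraticTwist hD0
  have hirrd : Wd.HasIrreducibleModPGaloisRep p :=
    X11b.hasIrreducibleModPGaloisRep_twist_model W p K hK.1 hirr Cd hWd
  have htam : padicValNat p Wd.tamagawaProduct = padicValNat p W.tamagawaProduct :=
    X11b.padicValNat_tamagawaProduct_twist_of_heegner W p hp5 K hK hHN Cd hWd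
  have hu : padicValRat p (Cd.u : ℚ) = 0 :=
    padicValRat_u_eq_zero_of_twist_minimal_of_split W p K hK hHp Cd hWd
  have hLt' : (W.quadraticTwist (NumberField.discr K : ℚ)).entireLFunction = Wd.entireLFunction := by
    rw [← hWd, entireLFunction_smul]
  have hLd1 : Wd.entireLFunction 1 ≠ 0 := by rw [← hLt']; exact hLt
  have hrd : Wd.analyticRank = 0 := (Wd.analyticRank_eq_zero_iff_holds (hmod Wd)).2 hLd1
  obtain ⟨qd, hqd, hvqd⟩ :=
    exists_printShape_lower_of_missingLowerBoundAt_rankZero (p := p) Wd hGZK hrd hirrd hlow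
  exact X11b.padicValNat_shaOrder_le_add_of_shaIndexBound W p (W.conductorNorm ℤ) K Dt H ι P hGZ hKo
    hGZK hmod hK hHN hP hp2 hc hμ hr hLt Wd Cd hWd hu htam ⟨qd, hqd, hvqd⟩ hU

/-! ### §3 Class level, any `p ≥ 5` -/

/-- **Kolyvagin's Tamagawa defect, rank one, ANY prime `p ≥ 5`, relative to the rank-zero Heegner
twists' lower halves.** For `W/ℚ` globally minimal with `ord_{s=1} L(E,s) = 1`, a prime `p ≥ 5` (any
reduction type) with `E[p]` irreducible and `ρ̄_{E,p}` onto, and a parametrisation datum `D` at level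
`N_E` with `p ∤ c(D)`: IF `MissingLowerBoundAt Wd p` holds for every globally minimal model `Wd` of
a rank-zero twist `E^{(d_K)}` by an imaginary quadratic `K` satisfying the Heegner hypothesis for
`N_E` AND for `p`, THEN `#Ш(E)_an = q ∈ ℚ` with `ord_p #Ш(E) ≤ ord_p q + 2·ord_p ∏_ℓ c_ℓ(E)`.
Binders (published): `hGZ`, `hKo`, `hB`, `hGZK`, `hmod`, `hnf`, `hFH`. Nothing booked.
[cite: McCallumLMS1991, §1 Theorem (Kolyvagin), p. 296] [cite: JetchevSkinnerWan2017, §7.4.2 (p. 31)]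
[cite: Darmon2004, Thm. 3.6 and §3.7] [cite: Miller2011LMS, Def. 1.1] -/
theorem padicValNat_shaOrder_le_add_of_rankOne_of_lowerTwists
    (hGZ : ∀ (N : ℕ) [NeZero N] (W : WeierstrassCurve ℚ) (K : Type) [Field K] [NumberField K],
      gross_zagier N W K)
    (hKo : ∀ (N : ℕ) [NeZero N] (W : WeierstrassCurve ℚ) (K : Type) [Field K] [NumberField K],
      kolyvagin N W K)
    (hB : ∀ (N : ℕ) [NeZero N] (W : WeierstrassCurve ℚ) (K : Type) [Field K] [NumberField K],
      Kolyvagin1990_padicValNat_card_sha_le N W K)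
    (hGZK : rank_eq_analyticRank_of_analyticRank_le_one) (hmod : hasEntireLFunction_rat)
    (hnf : exists_isNewformOf) (hFH : friedbergHoffstein_exists_heegnerField_split_twist_ne_zero)
    (W : WeierstrassCurve ℚ) [W.IsElliptic] [W.IsGloballyMinimal] (p : ℕ) [Fact p.Prime]
    [NeZero (W.conductorNorm ℤ)]
    (hirr : Irr W p) (hsurj : Surj W p) (hp5 : 5 ≤ p) (hr : W.analyticRank = 1)
    (D : ModularParametrizationData W (W.conductorNorm ℤ)) (hc : ¬ (p : ℤ) ∣ D.c)
    (hlow : ∀ (K : Type) [Field K] [NumberField K] (Wd : WeierstrassCurve ℚ) [Wd.IsElliptic]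
      [Wd.IsGloballyMinimal], IsImaginaryQuadratic K →
      SatisfiesHeegnerHypothesis (W.conductorNorm ℤ) K → SatisfiesHeegnerHypothesis p K →
      (∃ C : VariableChange ℚ, C • W.quadraticTwist (NumberField.discr K : ℚ) = Wd) →
      Wd.analyticRank = 0 → MissingLowerBoundAt Wd p) :
    ∃ q : ℚ, shaAn W = (q : ℂ) ∧
      (padicValNat p W.shaOrder : ℤ) ≤ padicValRat p q + 2 * padicValNat p W.tamagawaProduct := by
  have hp : p.Prime := Fact.out
  have hp2 : p ≠ 2 := by omega
  have hw : W.rootNumber = -1 := by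
    rw [WeierstrassCurve.rootNumber_eq_neg_one_pow_analyticRank_of_exists_isNewformOf hnf W, hr]
    norm_num
  obtain ⟨K, _, _, hK, hdisc, hHN, hHp, hLt⟩ := hFH W hw p hp 4
  have hμ : ¬ p ∣ Units.torsionOrder K := by
    haveI : IsTotallyComplex K := hK.2
    have hneg : NumberField.discr K < 0 := discr_neg_of_finrank_eq_two K hK.1
    have habs : ((NumberField.discr K).natAbs : ℤ) = -NumberField.discr K :=
      Int.ofNat_natAbs_of_nonpos hneg.le
    have h4 : NumberField.discr K < -4 := by
      have : (4 : ℤ) < ((NumberField.discr K).natAbs : ℤ) := by exact_mod_cast hdisc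
      omega
    rw [Literature.NumberTheory.DiophantineGeometry.torsionOrder_eq_two_of_discr_lt hK.1 h4]
    intro h2
    have := Nat.le_of_dvd two_pos h2
    omega
  obtain ⟨β, hβ⟩ := exists_dvd_sq_sub_discr_holds (W.conductorNorm ℤ) K hK hHN
  obtain ⟨H, -⟩ := nonempty_heegnerDatum_holds (W.conductorNorm ℤ) K hK hβ
  obtain ⟨ι⟩ : Nonempty (K →+* ℂ) := inferInstance
  obtain ⟨P, hP⟩ := heegnerPointComplex_mem_range_map_holds (W.conductorNorm ℤ) W K hK hHN D H ι
  have hD0 : (NumberField.discr K : ℚ) ≠ 0 := by exact_mod_cast NumberField.discr_ne_zero K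
  haveI hEt : (W.quadraticTwist (NumberField.discr K : ℚ)).IsElliptic :=
    W.isElliptic_quadraticTwist hD0
  obtain ⟨Cd, hCd⟩ := hasGlobalMinimalModel_rat_holds (W.quadraticTwist (NumberField.discr K : ℚ))
  haveI : (Cd • W.quadraticTwist (NumberField.discr K : ℚ)).IsGloballyMinimal := hCd
  have hWd : Cd • W.quadraticTwist (NumberField.discr K : ℚ) =
      Cd • W.quadraticTwist (NumberField.discr K : ℚ) := rfl
  have hrd : (Cd • W.quadraticTwist (NumberField.discr K : ℚ)).analyticRank = 0 := by
    rw [analyticRank_smul]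
    exact analyticRank_eq_zero_of_entireLFunction_one_ne_zero _ hLt
  have hlowd := hlow K (Cd • W.quadraticTwist (NumberField.discr K : ℚ)) hK hHN hHp ⟨Cd, rfl⟩ hrd
  exact padicValNat_shaOrder_le_add_of_heegnerData_of_lowerTwist' W p K D H ι P (hGZ _ W K)
    (hKo _ W K) hGZK hmod hr hp5 hirr hK hHN hHp hP hc hμ hLt
    (Cd • W.quadraticTwist (NumberField.discr K : ℚ)) Cd hWd hlowd
    (fun _ hnt ↦ hB _ W K hK hHN ⟨D, H, ι, hP⟩ hnt hp hp2 hsurj)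

/-- **The upper half on `p ∤ ∏ c_ℓ`, any `p ≥ 5`** (same hypotheses). [cite: Miller2011LMS, Def. 1.1] -/
theorem missingUpperBoundAt_of_rankOne_of_lowerTwists
    (hGZ : ∀ (N : ℕ) [NeZero N] (W : WeierstrassCurve ℚ) (K : Type) [Field K] [NumberField K],
      gross_zagier N W K)
    (hKo : ∀ (N : ℕ) [NeZero N] (W : WeierstrassCurve ℚ) (K : Type) [Field K] [NumberField K],
      kolyvagin N W K)
    (hB : ∀ (N : ℕ) [NeZero N] (W : WeierstrassCurve ℚ) (K : Type) [Field K] [NumberField K],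
      Kolyvagin1990_padicValNat_card_sha_le N W K)
    (hGZK : rank_eq_analyticRank_of_analyticRank_le_one) (hmod : hasEntireLFunction_rat)
    (hnf : exists_isNewformOf) (hFH : friedbergHoffstein_exists_heegnerField_split_twist_ne_zero)
    (W : WeierstrassCurve ℚ) [W.IsElliptic] [W.IsGloballyMinimal] (p : ℕ) [Fact p.Prime]
    [NeZero (W.conductorNorm ℤ)]
    (hirr : Irr W p) (hsurj : Surj W p) (hp5 : 5 ≤ p) (hr : W.analyticRank = 1)
    (D : ModularParametrizationData W (W.conductorNorm ℤ)) (hc : ¬ (p : ℤ) ∣ D.c)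
    (htam : ¬ p ∣ W.tamagawaProduct)
    (hlow : ∀ (K : Type) [Field K] [NumberField K] (Wd : WeierstrassCurve ℚ) [Wd.IsElliptic]
      [Wd.IsGloballyMinimal], IsImaginaryQuadratic K →
      SatisfiesHeegnerHypothesis (W.conductorNorm ℤ) K → SatisfiesHeegnerHypothesis p K →
      (∃ C : VariableChange ℚ, C • W.quadraticTwist (NumberField.discr K : ℚ) = Wd) →
      Wd.analyticRank = 0 → MissingLowerBoundAt Wd p) :
    MissingUpperBoundAt W p := by
  obtain ⟨q, hq, hle⟩ := padicValNat_shaOrder_le_add_of_rankOne_of_lowerTwists hGZ hKo hB hGZK hmod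
    hnf hFH W p hirr hsurj hp5 hr D hc hlow
  refine ⟨q, hq, ?_⟩
  rw [padicValNat.eq_zero_of_not_dvd htam, Nat.cast_zero, mul_zero, add_zero] at hle
  exact hle

/-- **`BSD(E,p)` in rank one, any `p ≥ 5`, from LOWER halves only** (same hypotheses, plus the pair's
own lower half). [cite: Miller2011LMS, Def. 1.1] -/
theorem bsdp_of_rankOne_of_lower_of_lowerTwists
    (hGZ : ∀ (N : ℕ) [NeZero N] (W : WeierstrassCurve ℚ) (K : Type) [Field K] [NumberField K],
      gross_zagier N W K)
    (hKo : ∀ (N : ℕ) [NeZero N] (W : WeierstrassCurve ℚ) (K : Type) [Field K] [NumberField K],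
      kolyvagin N W K)
    (hB : ∀ (N : ℕ) [NeZero N] (W : WeierstrassCurve ℚ) (K : Type) [Field K] [NumberField K],
      Kolyvagin1990_padicValNat_card_sha_le N W K)
    (hGZK : rank_eq_analyticRank_of_analyticRank_le_one) (hmod : hasEntireLFunction_rat)
    (hnf : exists_isNewformOf) (hFH : friedbergHoffstein_exists_heegnerField_split_twist_ne_zero)
    (W : WeierstrassCurve ℚ) [W.IsElliptic] [W.IsGloballyMinimal] (p : ℕ) [Fact p.Prime]
    [NeZero (W.conductorNorm ℤ)]
    (hirr : Irr W p) (hsurj : Surj W p) (hp5 : 5 ≤ p) (hr : W.analyticRank = 1)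
    (D : ModularParametrizationData W (W.conductorNorm ℤ)) (hc : ¬ (p : ℤ) ∣ D.c)
    (htam : ¬ p ∣ W.tamagawaProduct) (hlowW : MissingLowerBoundAt W p)
    (hlow : ∀ (K : Type) [Field K] [NumberField K] (Wd : WeierstrassCurve ℚ) [Wd.IsElliptic]
      [Wd.IsGloballyMinimal], IsImaginaryQuadratic K →
      SatisfiesHeegnerHypothesis (W.conductorNorm ℤ) K → SatisfiesHeegnerHypothesis p K →
      (∃ C : VariableChange ℚ, C • W.quadraticTwist (NumberField.discr K : ℚ) = Wd) →
      Wd.analyticRank = 0 → MissingLowerBoundAt Wd p) :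
    BSDp W p :=
  bsdp_of_missingPPartAt W p hGZK (by rw [hr])
    (missingPPartAt_of_lower_of_upper W p hlowW
      (missingUpperBoundAt_of_rankOne_of_lowerTwists hGZ hKo hB hGZK hmod hnf hFH W p hirr hsurj hp5 hr
        D hc htam hlow))

/-! ### §4 `p² ∤ N_E`: the Manin-unit datum discharged (modularity, Mazur 1978 Cor. 4.1, Néron) -/

/-- **Rank one, `p ≥ 5` with `p² ∤ N_E` (good or multiplicative `p`), `E[p]` irreducible, `ρ̄` onto:
the Tamagawa-defect inequality relative to the rank-zero twists' lower halves, with NO datum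
hypothesis** — the Manin-unit parametrisation datum exists by x11b's
`exists_modularParametrizationData_not_dvd` (optimal curve by modularity `hnf`, Mazur 1978 Cor. 4.1
`hMaz`, a cyclic prime-to-`p` isogeny and the Néron mapping property `hNS`).
[cite: Mazur1978, Cor. 4.1] [cite: McCallumLMS1991, §1 Theorem (Kolyvagin), p. 296]
[cite: Miller2011LMS, Def. 1.1] -/
theorem padicValNat_shaOrder_le_add_of_rankOne_of_lowerTwists_of_not_sq_dvd
    (hGZ : ∀ (N : ℕ) [NeZero N] (W : WeierstrassCurve ℚ) (K : Type) [Field K] [NumberField K],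
      gross_zagier N W K)
    (hKo : ∀ (N : ℕ) [NeZero N] (W : WeierstrassCurve ℚ) (K : Type) [Field K] [NumberField K],
      kolyvagin N W K)
    (hB : ∀ (N : ℕ) [NeZero N] (W : WeierstrassCurve ℚ) (K : Type) [Field K] [NumberField K],
      Kolyvagin1990_padicValNat_card_sha_le N W K)
    (hGZK : rank_eq_analyticRank_of_analyticRank_le_one) (hmod : hasEntireLFunction_rat)
    (hnf : exists_isNewformOf) (hFH : friedbergHoffstein_exists_heegnerField_split_twist_ne_zero)
    (hMaz : mazur_not_dvd_maninConstant_of_odd) (hNS : integral_neronScaling_of_isGloballyMinimal)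
    (W : WeierstrassCurve ℚ) [W.IsElliptic] [W.IsGloballyMinimal] (p : ℕ) [Fact p.Prime]
    [NeZero (W.conductorNorm ℤ)]
    (hirr : Irr W p) (hsurj : Surj W p) (hp5 : 5 ≤ p) (hr : W.analyticRank = 1)
    (hpN : ¬ p ^ 2 ∣ W.conductorNorm ℤ)
    (hlow : ∀ (K : Type) [Field K] [NumberField K] (Wd : WeierstrassCurve ℚ) [Wd.IsElliptic]
      [Wd.IsGloballyMinimal], IsImaginaryQuadratic K →
      SatisfiesHeegnerHypothesis (W.conductorNorm ℤ) K → SatisfiesHeegnerHypothesis p K →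
      (∃ C : VariableChange ℚ, C • W.quadraticTwist (NumberField.discr K : ℚ) = Wd) →
      Wd.analyticRank = 0 → MissingLowerBoundAt Wd p) :
    ∃ q : ℚ, shaAn W = (q : ℂ) ∧
      (padicValNat p W.shaOrder : ℤ) ≤ padicValRat p q + 2 * padicValNat p W.tamagawaProduct := by
  have hp : p.Prime := Fact.out
  have hp2 : p ≠ 2 := by omega
  obtain ⟨D, hc⟩ := X11b.exists_modularParametrizationData_not_dvd hnf hMaz hNS W rfl hp hp2 hpN hirr
  exact padicValNat_shaOrder_le_add_of_rankOne_of_lowerTwists hGZ hKo hB hGZK hmod hnf hFH W p hirr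
    hsurj hp5 hr D hc hlow

end Summit.BirchSwinnertonDyer.Rank1Residual.AdditivePotMult

end
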